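import Mathlib
import HarnessLib

/-!
# Classes in `ℚθ³ ⊕ W` are killed by no wedge with a covector: the monomial-support core of LEMMA W (ii)
# (WEIL-2 gen 26, STABILIZERS-G26 §3.1; sibling of `Ring2AbelianAllNonsplitWeilClassSupport`)

research route, not a corollary; conditional on HC_CM plus one named minimal statement.

Cell `pub-hodge-ring2-ab-*` (ALL ABELIAN VARIETIES), seat WEIL-2 gen 26, §3.1 / §6 of
`run/shared/lean/pub/pub-hodge-ring2/pub-hodge-ring2-ab-weil-2/STABILIZERS-G26.md`.

Informal setting (not formalised).  As in the sibling file: `H⁶(Y₀, ℂ) = ⊕ ℂ·e_I f_J`, `R_ns = ℚθ³ ⊕ W`, `θ³ = Σ δ_I e_I f_I`,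
`w₊ = e₊ f₋`, `w₋ = e₋ f₊` for the blocks `+ = P`, `− = N`.  The wedge with a (1,0)-covector `c` is
`c ∧ e_I f_J = Σ_{m ∉ I} ±c_m e_{I∪m} f_J`.  If a cycle lies in a translate of the sub-torus `ker c` its class is killed by `c ∧`;
LEMMA W (ii) says no non-zero class of `R_ns` is: the monomials produced have the pairwise different shapes `(I ∪ m, I)`, `(P ∪ j, N)`,
`(N ∪ i, P)`, each with a single source.  Consequence (COROLLARY W (b)): a closed subscheme of `E_ω⁶` of class in `R_ns ∖ 0` lies in no
proper sub-torus translate — e.g. no sub-cluster of the permutation-graph universes DP / U9pq (confined to `Σz₊ = Σz₋`) has such a class.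

Everything that does not matter is arbitrary: index type, disjoint blocks `P`, `N` with ≥ 2 elements inside a finite universe `T`, the
support `S` and non-zero coefficients `δ` of `θ³`, non-zero signs `ε`, any field; no `def` (the wedge is written out as sums of
`Finsupp.single`s).

* `wedge_apply_theta_key`, `wedge_apply_wplus_key`, `wedge_apply_offblock_key`, `wedge_apply_self_key` — single-source coefficients;
* `lemmaW_wedge` — vanishing of `c ∧ (λ•θ³ + a•w₊ + b•w₋)` forces `λ·c_m = 0` off each `I ∈ S`, `a·c_j = 0` on `N`, `b·c_i = 0` on `P`;
* `eq_zero_of_wedge_weilClass_eq_zero` — with `a ≠ 0 ≠ b`: `c = 0` on `P ∪ N`;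
* `fin6_eq_zero_of_wedge_weilClass_eq_zero` — the instance `P = {0,1,2}`, `N = {3,4,5}`, `T = univ`: `c = 0`.

0 sorry, no `def`, no named fact; `HC_CM` does not occur.
-/

namespace Summit.HodgeConjecture.Ring2AbelianAll.NonsplitWeilClassConfinement

open Finsupp BigOperators

variable {ι : Type*} [DecidableEq ι] {L : Type*} [Field L]


/-- Wedge, key fact 1 (θ-shapes): for `m ∉ I`, the coefficient of `(insert m I, I)` in `c ∧ (I', I')` is `c' * ε I m * c m` if `I' = I`
and `m ∈ T` (single source), else `0`.
research route, not a corollary; conditional on HC_CM plus one named minimal statement. [locator STABILIZERS-G26 §3.1] -/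
theorem wedge_apply_theta_key (T : Finset ι) (ε : Finset ι → ι → L) (c : ι → L) (I I' : Finset ι) {m : ι} (hm : m ∉ I)
    (hmT : m ∈ T) (c' : L) :
    (∑ m' ∈ T \ I', (c' * ε I' m' * c m') • Finsupp.single (insert m' I', I') (1 : L)) (insert m I, I)
      = if I' = I then c' * ε I m * c m else 0 := by
  rw [Finsupp.finsetSum_apply]
  split_ifs with h
  · subst h
    rw [Finset.sum_eq_single m]
    · simp
    · intro m' hm' hne
      rw [Finsupp.smul_apply, Finsupp.single_apply, if_neg, smul_zero]
      intro heq
      apply hne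
      have h1 : insert m' I' = insert m I' := congrArg Prod.fst heq
      have hm'I : m' ∉ I' := (Finset.mem_sdiff.1 hm').2
      have : m' ∈ insert m I' := h1 ▸ Finset.mem_insert_self m' I'
      rcases Finset.mem_insert.1 this with h' | h'
      · exact h'
      · exact absurd h' hm'I
    · intro hm'; exact absurd (Finset.mem_sdiff.2 ⟨hmT, hm⟩) hm'
  · apply Finset.sum_eq_zero
    intro m' _
    rw [Finsupp.smul_apply, Finsupp.single_apply, if_neg, smul_zero]
    intro heq
    exact h (congrArg Prod.snd heq)

/-- Wedge, key fact 2 (a block shape against θ-shapes): if `P ∩ N = ∅` and `N` has at least two elements then `(insert j P, N)` does not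
occur in `c ∧ (I', I')` for any `I'`.
research route, not a corollary; conditional on HC_CM plus one named minimal statement. [locator STABILIZERS-G26 §3.1] -/
theorem wedge_apply_wplus_key (T : Finset ι) (ε : Finset ι → ι → L) (c : ι → L) {P N : Finset ι} (hPN : Disjoint P N)
    (hN : 1 < N.card) (I' : Finset ι) (j : ι) (c' : L) :
    (∑ m' ∈ T \ I', (c' * ε I' m' * c m') • Finsupp.single (insert m' I', I') (1 : L)) (insert j P, N) = 0 := by
  rw [Finsupp.finsetSum_apply]
  apply Finset.sum_eq_zero
  intro m' _
  rw [Finsupp.smul_apply, Finsupp.single_apply, if_neg, smul_zero]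
  intro heq
  have h1 : insert m' I' = insert j P := congrArg Prod.fst heq
  have h2 : I' = N := congrArg Prod.snd heq
  subst h2
  -- N ⊆ insert m' N = insert j P, and N ∩ P = ∅, so N ⊆ {j}: contradicts 1 < N.card
  have hsub : I' ⊆ {j} := by
    intro x hx
    have hx' : x ∈ insert j P := h1 ▸ Finset.mem_insert_of_mem hx
    rcases Finset.mem_insert.1 hx' with h' | h'
    · exact Finset.mem_singleton.2 h'
    · exact absurd h' (Finset.disjoint_right.1 hPN hx)
  have := Finset.card_le_card hsub
  rw [Finset.card_singleton] at this
  omega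

/-- Wedge, key fact 3 (different second component): the coefficient of `(Q, N)` in `c ∧ (A, B)` is `0` when `B ≠ N`.
research route, not a corollary; conditional on HC_CM plus one named minimal statement. [locator STABILIZERS-G26 §3.1] -/
theorem wedge_apply_offblock_key (T : Finset ι) (ε : Finset ι → ι → L) (c : ι → L) {N A B : Finset ι} (hB : B ≠ N) (Q : Finset ι)
    (c' : L) :
    (∑ m' ∈ T \ A, (c' * ε A m' * c m') • Finsupp.single (insert m' A, B) (1 : L)) (Q, N) = 0 := by
  rw [Finsupp.finsetSum_apply]
  apply Finset.sum_eq_zero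
  intro m' _
  rw [Finsupp.smul_apply, Finsupp.single_apply, if_neg, smul_zero]
  intro heq
  exact hB (congrArg Prod.snd heq)

/-- Wedge, key fact 4 (single source inside a block): for `j ∈ T \ P` the coefficient of `(insert j P, N)` in `c ∧ (P, N)` is
`c' * ε P j * c j`.
research route, not a corollary; conditional on HC_CM plus one named minimal statement. [locator STABILIZERS-G26 §3.1] -/
theorem wedge_apply_self_key (T : Finset ι) (ε : Finset ι → ι → L) (c : ι → L) (P N : Finset ι) {j : ι} (hj : j ∈ T \ P) (c' : L) :
    (∑ m' ∈ T \ P, (c' * ε P m' * c m') • Finsupp.single (insert m' P, N) (1 : L)) (insert j P, N) = c' * ε P j * c j := by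
  rw [Finsupp.finsetSum_apply, Finset.sum_eq_single j]
  · simp
  · intro m' hm' hne
    rw [Finsupp.smul_apply, Finsupp.single_apply, if_neg, smul_zero]
    intro heq
    apply hne
    have h1 : insert m' P = insert j P := congrArg Prod.fst heq
    have hm'P : m' ∉ P := (Finset.mem_sdiff.1 hm').2
    have : m' ∈ insert j P := h1 ▸ Finset.mem_insert_self m' P
    rcases Finset.mem_insert.1 this with h' | h'
    · exact h'
    · exact absurd h' hm'P
  · intro hj'; exact absurd hj hj'

/-- **LEMMA W (ii), monomial-support core.**  If the wedge of `λ•θ³ + a•w₊ + b•w₋` with the covector `c` (summed over the index universe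
`T ⊇ P ∪ N`) vanishes, then `λ * c m = 0` for every `I ∈ S` and `m ∈ T \ I`, `a * c j = 0` for every `j ∈ N`, and `b * c i = 0` for every
`i ∈ P`.
research route, not a corollary; conditional on HC_CM plus one named minimal statement. [locator STABILIZERS-G26 §3.1 LEMMA W] -/
theorem lemmaW_wedge {P N T : Finset ι} (hPN : Disjoint P N) (hP : 1 < P.card) (hN : 1 < N.card) (hPT : P ⊆ T) (hNT : N ⊆ T)
    (S : Finset (Finset ι)) (δ : Finset ι → L) (hδ : ∀ I ∈ S, δ I ≠ 0)
    (ε : Finset ι → ι → L) (hε : ∀ I i, ε I i ≠ 0) (c : ι → L) (lam a b : L)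
    (h0 : (∑ I ∈ S, ∑ m ∈ T \ I, ((lam * δ I) * ε I m * c m) • Finsupp.single (insert m I, I) (1 : L))
          + (∑ m ∈ T \ P, (a * ε P m * c m) • Finsupp.single (insert m P, N) (1 : L))
          + (∑ m ∈ T \ N, (b * ε N m * c m) • Finsupp.single (insert m N, P) (1 : L)) = 0) :
    (∀ I ∈ S, ∀ m ∈ T \ I, lam * c m = 0) ∧ (∀ j ∈ N, a * c j = 0) ∧ (∀ i ∈ P, b * c i = 0) := by
  have hPN' : P ≠ N := by
    intro h; subst h
    have : P = ∅ := (Finset.disjoint_self_iff_empty P).1 hPN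
    subst this; simp at hP
  have hNP : Disjoint N P := hPN.symm
  refine ⟨?_, ?_, ?_⟩
  · intro I hI m hm
    have hmI : m ∉ I := (Finset.mem_sdiff.1 hm).2
    have hmT : m ∈ T := (Finset.mem_sdiff.1 hm).1
    have h := congrArg (fun x => x (insert m I, I)) h0
    simp only [Finsupp.add_apply, Finsupp.zero_apply] at h
    have hθ : (∑ I' ∈ S, ∑ m' ∈ T \ I', ((lam * δ I') * ε I' m' * c m') • Finsupp.single (insert m' I', I') (1 : L))
        (insert m I, I) = lam * δ I * ε I m * c m := by
      rw [Finsupp.finsetSum_apply, Finset.sum_eq_single I]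
      · rw [wedge_apply_theta_key T ε c I I hmI hmT, if_pos rfl]
      · intro I' _ hne
        rw [wedge_apply_theta_key T ε c I I' hmI hmT, if_neg hne]
      · intro hI'; exact absurd hI hI'
    -- w₊ at this key: (insert m' P, N) = (insert m I, I) forces I = N and P ⊆ insert m N, so P ⊆ {m}: contradiction
    have hwp : (∑ m' ∈ T \ P, (a * ε P m' * c m') • Finsupp.single (insert m' P, N) (1 : L)) (insert m I, I) = 0 := by
      rw [Finsupp.finsetSum_apply]
      apply Finset.sum_eq_zero
      intro m' _
      rw [Finsupp.smul_apply, Finsupp.single_apply, if_neg, smul_zero]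
      intro heq
      have h1 : insert m' P = insert m I := congrArg Prod.fst heq
      have h2 : N = I := congrArg Prod.snd heq
      have hsub : P ⊆ {m} := by
        intro x hx
        have hx' : x ∈ insert m I := h1 ▸ Finset.mem_insert_of_mem hx
        rcases Finset.mem_insert.1 hx' with h' | h'
        · exact Finset.mem_singleton.2 h'
        · exact absurd (h2 ▸ h') (Finset.disjoint_left.1 hPN hx)
      have := Finset.card_le_card hsub
      rw [Finset.card_singleton] at this
      omega
    have hwm : (∑ m' ∈ T \ N, (b * ε N m' * c m') • Finsupp.single (insert m' N, P) (1 : L)) (insert m I, I) = 0 := by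
      rw [Finsupp.finsetSum_apply]
      apply Finset.sum_eq_zero
      intro m' _
      rw [Finsupp.smul_apply, Finsupp.single_apply, if_neg, smul_zero]
      intro heq
      have h1 : insert m' N = insert m I := congrArg Prod.fst heq
      have h2 : P = I := congrArg Prod.snd heq
      have hsub : N ⊆ {m} := by
        intro x hx
        have hx' : x ∈ insert m I := h1 ▸ Finset.mem_insert_of_mem hx
        rcases Finset.mem_insert.1 hx' with h' | h'
        · exact Finset.mem_singleton.2 h'
        · exact absurd (h2 ▸ h') (Finset.disjoint_right.1 hPN hx)
      have := Finset.card_le_card hsub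
      rw [Finset.card_singleton] at this
      omega
    rw [hθ, hwp, hwm, add_zero, add_zero] at h
    have : lam * c m * (δ I * ε I m) = 0 := by rw [← h]; ring
    rcases mul_eq_zero.1 this with h' | h'
    · exact h'
    · exact absurd h' (mul_ne_zero (hδ I hI) (hε I m))
  · intro j hj
    have hjP : j ∈ T \ P := Finset.mem_sdiff.2 ⟨hNT hj, Finset.disjoint_right.1 hPN hj⟩
    have h := congrArg (fun x => x (insert j P, N)) h0
    simp only [Finsupp.add_apply, Finsupp.zero_apply] at h
    have hθ : (∑ I' ∈ S, ∑ m' ∈ T \ I', ((lam * δ I') * ε I' m' * c m') • Finsupp.single (insert m' I', I') (1 : L))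
        (insert j P, N) = 0 := by
      rw [Finsupp.finsetSum_apply]
      apply Finset.sum_eq_zero
      intro I' _
      exact wedge_apply_wplus_key T ε c hPN hN I' j (lam * δ I')
    have hwp := wedge_apply_self_key T ε c P N hjP a
    have hwm : (∑ m' ∈ T \ N, (b * ε N m' * c m') • Finsupp.single (insert m' N, P) (1 : L)) (insert j P, N) = 0 :=
      wedge_apply_offblock_key T ε c hPN' (insert j P) b
    rw [hθ, hwp, hwm, zero_add, add_zero] at h
    have : a * c j * ε P j = 0 := by rw [← h]; ring
    rcases mul_eq_zero.1 this with h' | h'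
    · exact h'
    · exact absurd h' (hε P j)
  · intro i hi
    have hiN : i ∈ T \ N := Finset.mem_sdiff.2 ⟨hPT hi, Finset.disjoint_left.1 hPN hi⟩
    have h := congrArg (fun x => x (insert i N, P)) h0
    simp only [Finsupp.add_apply, Finsupp.zero_apply] at h
    have hθ : (∑ I' ∈ S, ∑ m' ∈ T \ I', ((lam * δ I') * ε I' m' * c m') • Finsupp.single (insert m' I', I') (1 : L))
        (insert i N, P) = 0 := by
      rw [Finsupp.finsetSum_apply]
      apply Finset.sum_eq_zero
      intro I' _
      exact wedge_apply_wplus_key T ε c hNP hP I' i (lam * δ I')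
    have hwp : (∑ m' ∈ T \ P, (a * ε P m' * c m') • Finsupp.single (insert m' P, N) (1 : L)) (insert i N, P) = 0 :=
      wedge_apply_offblock_key T ε c (Ne.symm hPN') (insert i N) a
    have hwm := wedge_apply_self_key T ε c N P hiN b
    rw [hθ, hwp, hwm, zero_add, zero_add] at h
    have : b * c i * ε N i = 0 := by rw [← h]; ring
    rcases mul_eq_zero.1 this with h' | h'
    · exact h'
    · exact absurd h' (hε N i)

/-- **LEMMA W (ii) for a genuine Weil class**: with `a ≠ 0 ≠ b`, the wedge vanishes only if `c` vanishes on `P ∪ N` — in the account: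
a cycle of class `λθ³ + w`, `w ≠ 0`, lies in no translate of a proper sub-torus `ker c` (COROLLARY W (b): unconfined).
research route, not a corollary; conditional on HC_CM plus one named minimal statement. [locator STABILIZERS-G26 §3.2 COROLLARY W] -/
theorem eq_zero_of_wedge_weilClass_eq_zero {P N T : Finset ι} (hPN : Disjoint P N) (hP : 1 < P.card) (hN : 1 < N.card)
    (hPT : P ⊆ T) (hNT : N ⊆ T)
    (S : Finset (Finset ι)) (δ : Finset ι → L) (hδ : ∀ I ∈ S, δ I ≠ 0)
    (ε : Finset ι → ι → L) (hε : ∀ I i, ε I i ≠ 0) (c : ι → L) (lam a b : L) (ha : a ≠ 0) (hb : b ≠ 0)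
    (h0 : (∑ I ∈ S, ∑ m ∈ T \ I, ((lam * δ I) * ε I m * c m) • Finsupp.single (insert m I, I) (1 : L))
          + (∑ m ∈ T \ P, (a * ε P m * c m) • Finsupp.single (insert m P, N) (1 : L))
          + (∑ m ∈ T \ N, (b * ε N m * c m) • Finsupp.single (insert m N, P) (1 : L)) = 0) :
    ∀ i ∈ P ∪ N, c i = 0 := by
  obtain ⟨-, hp, hm2⟩ := lemmaW_wedge hPN hP hN hPT hNT S δ hδ ε hε c lam a b h0
  intro i hi
  rcases Finset.mem_union.1 hi with hiP | hiN
  · exact (mul_eq_zero.1 (hm2 i hiP)).resolve_left hb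
  · exact (mul_eq_zero.1 (hp i hiN)).resolve_left ha


/-- The account's instance: `ι = Fin 6`, `P = {0,1,2}`, `N = {3,4,5}`, `T = univ`: a Weil class `λθ³ + a w₊ + b w₋` (`a, b ≠ 0`) is
killed by `c ∧` only for `c = 0` — no cycle of such a class lies in a proper sub-torus translate of `E_ω⁶`.
research route, not a corollary; conditional on HC_CM plus one named minimal statement. [locator STABILIZERS-G26 §3.2] -/
theorem fin6_eq_zero_of_wedge_weilClass_eq_zero
    (S : Finset (Finset (Fin 6))) (δ : Finset (Fin 6) → L) (hδ : ∀ I ∈ S, δ I ≠ 0)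
    (ε : Finset (Fin 6) → Fin 6 → L) (hε : ∀ I i, ε I i ≠ 0) (c : Fin 6 → L) (lam a b : L) (ha : a ≠ 0) (hb : b ≠ 0)
    (h0 : (∑ I ∈ S, ∑ m ∈ Finset.univ \ I, ((lam * δ I) * ε I m * c m) • Finsupp.single (insert m I, I) (1 : L))
          + (∑ m ∈ Finset.univ \ ({0, 1, 2} : Finset (Fin 6)), (a * ε {0, 1, 2} m * c m) •
              Finsupp.single (insert m ({0, 1, 2} : Finset (Fin 6)), ({3, 4, 5} : Finset (Fin 6))) (1 : L))
          + (∑ m ∈ Finset.univ \ ({3, 4, 5} : Finset (Fin 6)), (b * ε {3, 4, 5} m * c m) •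
              Finsupp.single (insert m ({3, 4, 5} : Finset (Fin 6)), ({0, 1, 2} : Finset (Fin 6))) (1 : L)) = 0) :
    c = 0 := by
  have hPN : Disjoint ({0, 1, 2} : Finset (Fin 6)) {3, 4, 5} := by decide
  have h := eq_zero_of_wedge_weilClass_eq_zero hPN (by decide) (by decide) (Finset.subset_univ _) (Finset.subset_univ _)
    S δ hδ ε hε c lam a b ha hb h0
  funext i
  apply h
  have : ({0, 1, 2} : Finset (Fin 6)) ∪ {3, 4, 5} = Finset.univ := by decide
  rw [this]; exact Finset.mem_univ i

end Summit.HodgeConjecture.Ring2AbelianAll.NonsplitWeilClassConfinement
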